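import Mathlib.Tactic
import HarnessLib

/-!
# Kozma–Nitzan's Question 8 at three relays — THEOREM NX′₂: the k = 2 case of CONJECTURE NX′ (gen 30)

Support file (`--supports stmt-CriticalPhenomena-4575`, closed crux; independent mathematics on Kozma–Nitzan's Question 8,
arXiv:2401.12397 §5.5 p. 36), prover `prim-ineq-gen-6` (gen 30).  No definitions, no named facts, no sorries; standard axioms.
Memo `run/shared/lean/prim/prim-ineq-gen-6/PROOF-NX2-G30.md`.

Setting (path-end block, `c > 0`, one positive depth `k₁ = 1`): depth 0 emits `g₀ = (1−s₁)|Ũ₀|/(a₀p₀) > 0`, depth 1 kills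
`|g₁| = (1−s₂)Ũ₁/(a₁p₁)`.  THEOREM NX′₂: if the C-defect of `F = [1,2]` exceeds the threshold,
`X₂ = (1−C₁C₂)/(C₁C₂) − λ > 0` (`λ = a₀Φs₁/(Φ+m)`), then `|g₁| ≥ g₀`, so depths 1 and 2 are not hypothesis depths
((Q-A) there is vacuous).  The kernels below are the algebraic cores of the proof:
* `k2_class_defect_term` — the per-class joint-defect bound behind the defect decomposition of `1 − Φ(T₁)` (S2);
* `k2_blind_bound_identity` — the IMPROVED BLIND BOUND (S3): `a₀λu₁ − (1−p₀) ≤ B0 = (1−A₁)C₁[(1−s₂)p₁W − s₂m₂X′] − u₂[(1−s₂)δ₂ + s₂C₁X′]`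
  (exact coefficient identity given the channel decomposition of `u₁` and the defect decomposition);
* `k2_kill_lower_core` — the R-kill at depth 1: `R̃₁ ≥ ¾γ₀C₁(1−A₁)(Φ+m)`;
* `k2_reduction_core` — `|g₁| ≥ g₀` from the two bounds and the comparison inequality (E2″);
* `rc_k2` — the reduced 6-variable claim (RC) `¾·P·v ≥ (1−D−W)A²W(1−z)[CD(ω+(1−ω)m) + (1−ω)v]` (here multiplied by `1−A`,
  with `(1−z)(1−A) = s−A`, `s = v+m`), proved from its four corners (`rc_corner_I … IV`) by affinity in `ω` and concavity in `v`
  (`concave_between`).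
[cite: KozmaNitzan2024, Question 8 (§5.5 p. 36)]
-/

namespace Summit.CriticalPhenomena.PercolationContinuityZ3.Theorems

namespace PocketCert

/-- **Per-class joint-defect bound (S2).**  For a class of `T₁` passing the open edge `e₂` and ending at `l ≥ 2`, with far factor
`p ∈ [0,1]`, A-mark `A₁·A′` and C-mark `C₁·C₂·C″` (`A′ = A_[2,l]`, `C″ = C_[3,l]`, all in `[0,1]`):
`p(1 − A₁A′)(1 − C₁C₂C″) ≥ p[(1−A′) + A′(1−A₁)]·(1 − C₁C₂)·C″` — the joint defect dominates
`(A-defect mass) × (1−C₁C₂) × C″`, which sums to `C₁Δ₁₂[u₂ + (1−A₁)m₂]` over the classes.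
[cite: KozmaNitzan2024, Question 8 (§5.5 p. 36)] -/
theorem k2_class_defect_term (p A₁ A' C₁ C₂ C'' : ℝ) (hp : 0 ≤ p) (hA₁1 : A₁ ≤ 1)
    (hA' : 0 ≤ A') (hA'1 : A' ≤ 1) (hC₁ : 0 ≤ C₁) (hC₁1 : C₁ ≤ 1) (hC₂ : 0 ≤ C₂) (hC₂1 : C₂ ≤ 1)
    (hC''1 : C'' ≤ 1) :
    p * ((1 - A') + A' * (1 - A₁)) * (1 - C₁ * C₂) * C'' ≤ p * (1 - A₁ * A') * (1 - C₁ * C₂ * C'') := by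
  have e1 : (1 - A') + A' * (1 - A₁) = 1 - A₁ * A' := by ring
  have h1 : 0 ≤ 1 - A₁ * A' := by nlinarith [mul_le_mul hA₁1 hA'1 hA' (by norm_num : (0:ℝ) ≤ 1)]
  have hx : 0 ≤ C₁ * C₂ := mul_nonneg hC₁ hC₂
  have hx1 : C₁ * C₂ ≤ 1 := by nlinarith [mul_le_mul hC₁1 hC₂1 hC₂ (by norm_num : (0:ℝ) ≤ 1)]
  have h2 : (1 - C₁ * C₂) * C'' ≤ 1 - C₁ * C₂ * C'' := by nlinarith
  rw [e1]
  have := mul_le_mul_of_nonneg_left h2 (mul_nonneg hp h1)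
  nlinarith [this]

/-- **The improved blind bound (S3), coefficient identity.**  With `u₁ = C₁[(1−A₁)m̃ + s₂u₂]`, `m̃ = (1−s₂)p₁ + s₂m₂`,
`1 − C₁ = δ₁C₁`, `W = α − δ₁`, `X′ = Δ − α` (here `α = a₀λ`, `Δ = Δ₁₂`) and the defect decomposition
`DEF := (1−s₂)p₁(1−A₁)(1−C₁) + (1−s₂)δ₂u₂ + s₂C₁Δ[u₂ + (1−A₁)m₂]` (a lower bound of `1 − p₀`):
`α·u₁ − DEF = B0 := (1−A₁)C₁[(1−s₂)p₁W − s₂m₂X′] − u₂[(1−s₂)δ₂ + s₂C₁X′]` — hence `SL′ = αu₁ − (1−p₀) ≤ B0`.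
[cite: KozmaNitzan2024, Question 8 (§5.5 p. 36)] -/
theorem k2_blind_bound_identity (u₁ u₂ m₂ p₁ s₂ A₁ C₁ δ₁ δ₂ Δ α W X' mt DEF B0 : ℝ)
    (hmt : mt = (1 - s₂) * p₁ + s₂ * m₂) (hu₁ : u₁ = C₁ * ((1 - A₁) * mt + s₂ * u₂)) (hδC : 1 - C₁ = δ₁ * C₁)
    (hW : W = α - δ₁) (hX : X' = Δ - α)
    (hDEF : DEF = (1 - s₂) * p₁ * (1 - A₁) * (1 - C₁) + (1 - s₂) * δ₂ * u₂ + s₂ * C₁ * Δ * (u₂ + (1 - A₁) * m₂))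
    (hB0 : B0 = (1 - A₁) * C₁ * ((1 - s₂) * p₁ * W - s₂ * m₂ * X') - u₂ * ((1 - s₂) * δ₂ + s₂ * C₁ * X')) :
    α * u₁ - DEF = B0 := by
  rw [hB0, hDEF, hu₁, hmt, hW, hX]
  linear_combination (-(1 - s₂) * p₁ * (1 - A₁)) * hδC

/-- **Consequence: the blind bound as an inequality.**  If `1 − p₀ ≥ DEF` then `SL′ = αu₁ − (1−p₀) ≤ B0`.
[cite: KozmaNitzan2024, Question 8 (§5.5 p. 36)] -/
theorem k2_blind_bound_le (u₁ q DEF B0 α SL : ℝ) (hid : α * u₁ - DEF = B0) (hq : DEF ≤ q)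
    (hSL : SL = α * u₁ - q) : SL ≤ B0 := by
  rw [hSL]; linarith

/-- **The R-kill at depth 1 (S4).**  `R̃₁ = γ₁[(1−a₁)K₃ + a₁K₄ − a₀(1−A₁)η₀]` with `γ₁ = γ₀C₁`, `a₁ = a₀A₁`, `0 ≤ a₀ ≤ 1`,
`0 ≤ A₁ ≤ 1`, `K₄ ≥ 0`, `K₃ − η₀⁺ ≥ ¾(Φ+m)` (from `c ≤ Φ/4`, `η₀ ≤ m/4`), `η₀ ≤ η₀⁺`, `0 ≤ η₀⁺`:
`R̃₁ ≥ ¾·γ₀C₁(1−A₁)(Φ+m)`.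
[cite: KozmaNitzan2024, Question 8 (§5.5 p. 36)] -/
theorem k2_kill_lower_core (Rt γ₀ C₁ a₀ A₁ K₃ K₄ η₀ ηp PM : ℝ) (hγ₀ : 0 ≤ γ₀) (hC₁ : 0 ≤ C₁)
    (ha₀ : 0 ≤ a₀) (ha₀1 : a₀ ≤ 1) (hA₁ : 0 ≤ A₁) (hA₁1 : A₁ ≤ 1) (hK₄ : 0 ≤ K₄) (hηp : 0 ≤ ηp) (hη : η₀ ≤ ηp)
    (hK₃ : 3 / 4 * PM ≤ K₃ - ηp) (hPM : 0 ≤ PM)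
    (hRt : Rt = γ₀ * C₁ * ((1 - a₀ * A₁) * K₃ + a₀ * A₁ * K₄ - a₀ * (1 - A₁) * η₀)) :
    3 / 4 * γ₀ * C₁ * (1 - A₁) * PM ≤ Rt := by
  have hg : 0 ≤ γ₀ * C₁ := mul_nonneg hγ₀ hC₁
  have h1 : a₀ * (1 - A₁) ≤ 1 - a₀ * A₁ := by nlinarith
  have h2 : 1 - A₁ ≤ 1 - a₀ * A₁ := by nlinarith
  have h3 : 0 ≤ 1 - a₀ * A₁ := by nlinarith
  have h4 : (1 - a₀ * A₁) * (K₃ - ηp) ≤ (1 - a₀ * A₁) * K₃ + a₀ * A₁ * K₄ - a₀ * (1 - A₁) * η₀ := by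
    have : a₀ * (1 - A₁) * η₀ ≤ (1 - a₀ * A₁) * ηp := by
      calc a₀ * (1 - A₁) * η₀ ≤ a₀ * (1 - A₁) * ηp :=
            mul_le_mul_of_nonneg_left hη (mul_nonneg ha₀ (by linarith))
        _ ≤ (1 - a₀ * A₁) * ηp := mul_le_mul_of_nonneg_right h1 hηp
    nlinarith [mul_nonneg (mul_nonneg ha₀ hA₁) hK₄]
  have h5 : (1 - A₁) * (3 / 4 * PM) ≤ (1 - a₀ * A₁) * (K₃ - ηp) := by
    calc (1 - A₁) * (3 / 4 * PM) ≤ (1 - a₀ * A₁) * (3 / 4 * PM) :=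
          mul_le_mul_of_nonneg_right h2 (by nlinarith)
      _ ≤ (1 - a₀ * A₁) * (K₃ - ηp) := mul_le_mul_of_nonneg_left hK₃ h3
  rw [hRt]
  have := mul_le_mul_of_nonneg_left (le_trans h5 h4) hg
  nlinarith [this]

/-- **Reduction core (S5).**  `|g₁| ≥ g₀` reads `(1−s₂)a₀p₀Ũ₁ ≥ (1−s₁)a₁p₁|Ũ₀|` (`a₁ = a₀A₁`).  It follows from the blind bound
`|Ũ₀| ≤ γ₀(Φ+m)v₁B0`, the kill bound `Ũ₁ ≥ ¾γ₀C₁(1−A₁)(Φ+m)v₂` and the comparison inequality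
(E2″) `¾(1−s₂)p₀C₁(1−A₁)v₂ ≥ (1−s₁)A₁p₁v₁B0`.
[cite: KozmaNitzan2024, Question 8 (§5.5 p. 36)] -/
theorem k2_reduction_core (Ut0 Ut1 γ₀ PM v₁ v₂ B0 C₁ A₁ a₀ p₀ p₁ s₁ s₂ : ℝ)
    (hγ : 0 ≤ γ₀) (hPM : 0 ≤ PM) (ha₀ : 0 ≤ a₀) (hA₁ : 0 ≤ A₁) (hp₀ : 0 ≤ p₀) (hp₁ : 0 ≤ p₁) (hs₁ : s₁ ≤ 1) (hs₂ : s₂ ≤ 1)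
    (hU0 : Ut0 ≤ γ₀ * PM * v₁ * B0) (hU1 : 3 / 4 * γ₀ * C₁ * (1 - A₁) * PM * v₂ ≤ Ut1)
    (hE2 : (1 - s₁) * A₁ * p₁ * v₁ * B0 ≤ 3 / 4 * (1 - s₂) * p₀ * C₁ * (1 - A₁) * v₂) :
    (1 - s₁) * (a₀ * A₁) * p₁ * Ut0 ≤ (1 - s₂) * a₀ * p₀ * Ut1 := by
  have c1 : 0 ≤ (1 - s₁) * (a₀ * A₁) * p₁ := by
    have : 0 ≤ 1 - s₁ := by linarith
    positivity
  have c2 : 0 ≤ (1 - s₂) * a₀ * p₀ := by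
    have : 0 ≤ 1 - s₂ := by linarith
    positivity
  calc (1 - s₁) * (a₀ * A₁) * p₁ * Ut0 ≤ (1 - s₁) * (a₀ * A₁) * p₁ * (γ₀ * PM * v₁ * B0) :=
        mul_le_mul_of_nonneg_left hU0 c1
    _ = a₀ * γ₀ * PM * ((1 - s₁) * A₁ * p₁ * v₁ * B0) := by ring
    _ ≤ a₀ * γ₀ * PM * (3 / 4 * (1 - s₂) * p₀ * C₁ * (1 - A₁) * v₂) :=
        mul_le_mul_of_nonneg_left hE2 (by positivity)
    _ = (1 - s₂) * a₀ * p₀ * (3 / 4 * γ₀ * C₁ * (1 - A₁) * PM * v₂) := by ring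
    _ ≤ (1 - s₂) * a₀ * p₀ * Ut1 := mul_le_mul_of_nonneg_left hU1 c2

/-- **Concave interpolation.**  A function that is a concave quadratic along a segment, `f(v) = α + βv − γv²` with `γ ≥ 0`,
and nonnegative at the endpoints `v₀ ≤ v₁`, is nonnegative on `[v₀, v₁]`.
[cite: KozmaNitzan2024, Question 8 (§5.5 p. 36)] -/
theorem concave_between (α β γ v₀ v₁ v : ℝ) (hγ : 0 ≤ γ) (h0 : 0 ≤ α + β * v₀ - γ * v₀ ^ 2)
    (h1 : 0 ≤ α + β * v₁ - γ * v₁ ^ 2) (hv0 : v₀ ≤ v) (hv1 : v ≤ v₁) : 0 ≤ α + β * v - γ * v ^ 2 := by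
  rcases eq_or_lt_of_le (le_trans hv0 hv1) with heq | hlt
  · have : v = v₀ := le_antisymm (heq ▸ hv1) hv0
    rw [this]; exact h0
  · -- v = (1-t) v₀ + t v₁ with t = (v - v₀)/(v₁ - v₀)
    set d := v₁ - v₀ with hd
    have hdpos : 0 < d := by rw [hd]; linarith
    have key : d ^ 2 * (α + β * v - γ * v ^ 2)
        = d * (v₁ - v) * (α + β * v₀ - γ * v₀ ^ 2) + d * (v - v₀) * (α + β * v₁ - γ * v₁ ^ 2)
          + γ * d ^ 2 * (v - v₀) * (v₁ - v) := by rw [hd]; ring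
    have hA : 0 ≤ d * (v₁ - v) * (α + β * v₀ - γ * v₀ ^ 2) :=
      mul_nonneg (mul_nonneg hdpos.le (by linarith)) h0
    have hB : 0 ≤ d * (v - v₀) * (α + β * v₁ - γ * v₁ ^ 2) :=
      mul_nonneg (mul_nonneg hdpos.le (by linarith)) h1
    have hC : 0 ≤ γ * d ^ 2 * (v - v₀) * (v₁ - v) :=
      mul_nonneg (mul_nonneg (mul_nonneg hγ (by positivity)) (by linarith)) (by linarith)
    have hd2 : 0 < d ^ 2 := by positivity
    by_contra hneg
    have hneg' : α + β * v - γ * v ^ 2 < 0 := lt_of_not_ge hneg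
    have : d ^ 2 * (α + β * v - γ * v ^ 2) < 0 := mul_neg_of_pos_of_neg hd2 hneg'
    linarith [key]

/-- **Corner I of (RC)** (`ω = 1`, `m = 0`, `v = s`): `¾·M·s·(1−A) ≥ (1−D−W)·A²·W·(s−A)·C·D` for `M = A + C − AC`,
`C(1+D) = 1`, `0 ≤ D`, `0 ≤ W`, `D + W ≤ 1`, `0 ≤ A ≤ s ≤ 1`.
[cite: KozmaNitzan2024, Question 8 (§5.5 p. 36)] -/
theorem rc_corner_I (D W A s C : ℝ) (hD : 0 ≤ D) (hW : 0 ≤ W) (hDW : D + W ≤ 1) (hA : 0 ≤ A) (hAs : A ≤ s)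
    (hs : s ≤ 1) (hC : C * (1 + D) = 1) :
    (1 - D - W) * A ^ 2 * W * (s - A) * C * D ≤ 3 / 4 * (A + C - A * C) * s * (1 - A) := by
  have hCpos : 0 < C := by nlinarith
  have hC1 : C ≤ 1 := by nlinarith
  have h1 : s - A ≤ s * (1 - A) := by nlinarith
  have hQ : (1 - D - W) * W * D ≤ 1 / 4 := by nlinarith [sq_nonneg (1 - D - 2 * W), mul_nonneg hD hW]
  have hQ0 : 0 ≤ (1 - D - W) * W * D := mul_nonneg (mul_nonneg (by linarith) hW) hD
  have hA1 : A ≤ 1 := le_trans hAs hs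
  have hA2 : A ^ 2 ≤ 1 := by nlinarith
  have hsA : 0 ≤ s * (1 - A) := mul_nonneg (le_trans hA hAs) (by linarith)
  have hM : C ≤ A + C - A * C := by nlinarith
  calc (1 - D - W) * A ^ 2 * W * (s - A) * C * D
      = ((1 - D - W) * W * D) * (A ^ 2 * C) * (s - A) := by ring
    _ ≤ ((1 - D - W) * W * D) * (A ^ 2 * C) * (s * (1 - A)) :=
        mul_le_mul_of_nonneg_left h1 (mul_nonneg hQ0 (by positivity))
    _ ≤ (1 / 4) * (1 * C) * (s * (1 - A)) := by
        apply mul_le_mul_of_nonneg_right _ hsA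
        exact mul_le_mul hQ (mul_le_mul_of_nonneg_right hA2 hCpos.le) (by positivity) (by norm_num)
    _ ≤ 3 / 4 * (A + C - A * C) * s * (1 - A) := by nlinarith [mul_le_mul_of_nonneg_right hM hsA]

/-- **Corner II of (RC)** (`ω = 0`, `m = 0`, `v = s`): `¾·(C(1−s) + As)·s·(1−A) ≥ (1−D−W)·A²·W·(s−A)·s`.
[cite: KozmaNitzan2024, Question 8 (§5.5 p. 36)] -/
theorem rc_corner_II (D W A s C : ℝ) (hD : 0 ≤ D) (hW : 0 ≤ W) (hDW : D + W ≤ 1) (hA : 0 ≤ A) (hAs : A ≤ s)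
    (hs : s ≤ 1) (hC0 : 0 ≤ C) :
    (1 - D - W) * A ^ 2 * W * (s - A) * s ≤ 3 / 4 * (C * (1 - s) + A * s) * s * (1 - A) := by
  have h1 : s - A ≤ s * (1 - A) := by nlinarith
  have hQ : (1 - D - W) * W ≤ 1 / 4 := by nlinarith [sq_nonneg (1 - D - 2 * W)]
  have hQ0 : 0 ≤ (1 - D - W) * W := mul_nonneg (by linarith) hW
  have hs0 : 0 ≤ s := le_trans hA hAs
  have hA1 : A ≤ 1 := le_trans hAs hs
  have hsA : 0 ≤ s * (1 - A) := mul_nonneg hs0 (by linarith)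
  calc (1 - D - W) * A ^ 2 * W * (s - A) * s
      = ((1 - D - W) * W) * (A ^ 2 * s) * (s - A) := by ring
    _ ≤ ((1 - D - W) * W) * (A ^ 2 * s) * (s * (1 - A)) :=
        mul_le_mul_of_nonneg_left h1 (mul_nonneg hQ0 (by positivity))
    _ ≤ (1 / 4) * (A ^ 2 * s) * (s * (1 - A)) :=
        mul_le_mul_of_nonneg_right (mul_le_mul_of_nonneg_right hQ (by positivity)) hsA
    _ ≤ 3 / 4 * (C * (1 - s) + A * s) * s * (1 - A) := by
        have hCs : 0 ≤ C * (1 - s) := mul_nonneg hC0 (by linarith)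
        nlinarith [mul_nonneg hCs hsA, mul_nonneg (mul_nonneg hA hs0) hsA, mul_nonneg hA hsA]

/-- **Corner III of (RC)** (`ω = 1`, `v = CWm`, i.e. `v(1+CW) = CWs`, `m = s − v`): with `M = A + C − AC`,
`¾·M·v·(1−A) ≥ (1−D−W)·A²·W·(s−A)·C·D`.
[cite: KozmaNitzan2024, Question 8 (§5.5 p. 36)] -/
theorem rc_corner_III (D W A s C v : ℝ) (hD : 0 ≤ D) (hW : 0 ≤ W) (hDW : D + W ≤ 1) (hA : 0 ≤ A) (hAs : A ≤ s)
    (hs : s ≤ 1) (hC : C * (1 + D) = 1) (hv : v * (1 + C * W) = C * W * s) :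
    (1 - D - W) * A ^ 2 * W * (s - A) * C * D ≤ 3 / 4 * (A + C - A * C) * v * (1 - A) := by
  have hCpos : 0 < C := by nlinarith
  have hC1 : C ≤ 1 := by nlinarith
  have hCW : 0 ≤ C * W := mul_nonneg hCpos.le hW
  have hs0 : 0 ≤ s := le_trans hA hAs
  have hA1 : A ≤ 1 := le_trans hAs hs
  have h1 : s - A ≤ s * (1 - A) := by nlinarith
  have hsA : 0 ≤ s * (1 - A) := mul_nonneg hs0 (by linarith)
  have hL : (1 - D - W) * (1 + C * W) ≤ 1 - D := by nlinarith [mul_nonneg hW hCW, mul_nonneg hD hCW]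
  have hM : A ≤ A + C - A * C := by nlinarith
  have hMpos : 0 ≤ A + C - A * C := by nlinarith
  have key : (1 - D - W) * (1 + C * W) * A ^ 2 * (s - A) * D ≤ 3 / 4 * (A + C - A * C) * (s * (1 - A)) := by
    calc (1 - D - W) * (1 + C * W) * A ^ 2 * (s - A) * D
        ≤ (1 - D) * A ^ 2 * (s * (1 - A)) * D := by
          have := mul_le_mul hL h1 (by linarith) (by linarith)
          nlinarith [mul_le_mul_of_nonneg_right this (mul_nonneg (pow_nonneg hA 2) hD)]
      _ = ((1 - D) * D) * A ^ 2 * (s * (1 - A)) := by ring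
      _ ≤ (1 / 4) * A * (s * (1 - A)) := by
          have hq : (1 - D) * D ≤ 1 / 4 := by nlinarith [sq_nonneg (1 - 2 * D)]
          have hA2 : A ^ 2 ≤ A := by nlinarith
          have := mul_le_mul hq hA2 (pow_nonneg hA 2) (by norm_num)
          exact mul_le_mul_of_nonneg_right this hsA
      _ ≤ 3 / 4 * (A + C - A * C) * (s * (1 - A)) := by nlinarith [mul_le_mul_of_nonneg_right hM hsA]
  have hv' : 3 / 4 * (A + C - A * C) * v * (1 - A) * (1 + C * W)
      = 3 / 4 * (A + C - A * C) * (s * (1 - A)) * (C * W) := by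
    have : v * (1 + C * W) = C * W * s := hv
    calc 3 / 4 * (A + C - A * C) * v * (1 - A) * (1 + C * W)
        = 3 / 4 * (A + C - A * C) * (1 - A) * (v * (1 + C * W)) := by ring
      _ = 3 / 4 * (A + C - A * C) * (s * (1 - A)) * (C * W) := by rw [this]; ring
  have hpos : 0 < 1 + C * W := by linarith
  have target : (1 - D - W) * A ^ 2 * W * (s - A) * C * D * (1 + C * W)
      ≤ 3 / 4 * (A + C - A * C) * v * (1 - A) * (1 + C * W) := by
    rw [hv']
    have := mul_le_mul_of_nonneg_right key hCW
    nlinarith [this]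
  exact le_of_mul_le_mul_right target hpos

/-- **Corner IV of (RC)** (`ω = 0`, `v = CWm`, i.e. `v(1+CW) = CWs`): with `P = C + A(1−C)s − C(1−A)v`
(the value of `P` at `ω = 0`, `m = s − v`), the corner inequality
`¾·P·v·(1−A) ≥ (1−D−W)·A²·W·(s−A)·(C·D·(s−v) + v)`.
[cite: KozmaNitzan2024, Question 8 (§5.5 p. 36)] -/
theorem rc_corner_IV (D W A s C v P : ℝ) (hD : 0 ≤ D) (hW : 0 ≤ W) (hDW : D + W ≤ 1) (hA : 0 ≤ A) (hAs : A ≤ s)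
    (hs : s ≤ 1) (hC : C * (1 + D) = 1) (hv : v * (1 + C * W) = C * W * s)
    (hP : P = C + A * (1 - C) * s - C * (1 - A) * v) :
    (1 - D - W) * A ^ 2 * W * (s - A) * (C * D * (s - v) + v) ≤ 3 / 4 * P * v * (1 - A) := by
  have hCpos : 0 < C := by nlinarith
  have hC1 : C ≤ 1 := by nlinarith
  have hCW : 0 ≤ C * W := mul_nonneg hCpos.le hW
  have hs0 : 0 ≤ s := le_trans hA hAs
  have hA1 : A ≤ 1 := le_trans hAs hs
  have hpos : 0 < 1 + C * W := by linarith
  have hCD : 1 - C = C * D := by linarith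
  have hDWn : 0 ≤ D + W := by linarith
  have hbr : (C * D * (s - v) + v) * (1 + C * W) = C * (D + W) * s := by
    have e1 : (C * D * (s - v) + v) * (1 + C * W)
        = C * D * s * (1 + C * W) + (1 - C * D) * (v * (1 + C * W)) := by ring
    have e2 : 1 - C * D = C := by linarith
    rw [e1, hv, e2]
    linear_combination (C * W * s) * hC
  have hPm : P * (1 + C * W) = C * (1 + C * W) + s * C * (A * (D + W) - C * W) := by
    have e3 : P * (1 + C * W) = (C + A * (1 - C) * s) * (1 + C * W) - C * (1 - A) * (v * (1 + C * W)) := by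
      rw [hP]; ring
    rw [e3, hv, hCD]
    linear_combination (A * s * C * W) * hC
  have hx : (1 - D - W) * (D + W) ≤ 1 / 4 := by nlinarith [sq_nonneg (1 - 2 * (D + W))]
  have hx0 : 0 ≤ (1 - D - W) * (D + W) := mul_nonneg (by linarith) hDWn
  have hA2 : A ^ 2 ≤ 1 := by nlinarith
  have M3 : (1 - D - W) * (D + W) * A ^ 2 * (1 + C * W) ≤ 3 / 4 * (P * (1 + C * W)) := by
    rcases le_or_gt (C * W) (A * (D + W)) with hcase | hcase
    · -- case a: P(1+CW) ≥ C(1+CW), C ≥ 1/2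
      have hge : C * (1 + C * W) ≤ P * (1 + C * W) := by
        rw [hPm]
        have : 0 ≤ s * C * (A * (D + W) - C * W) := mul_nonneg (mul_nonneg hs0 hCpos.le) (by linarith)
        linarith
      have hChalf : 1 / 2 ≤ C := by nlinarith
      have h1 : (1 - D - W) * (D + W) * A ^ 2 ≤ 1 / 4 := by
        calc (1 - D - W) * (D + W) * A ^ 2 ≤ (1 / 4) * 1 := mul_le_mul hx hA2 (pow_nonneg hA 2) (by norm_num)
          _ = 1 / 4 := by ring
      have h2 : (1 - D - W) * (D + W) * A ^ 2 * (1 + C * W) ≤ (1 / 4) * (1 + C * W) :=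
        mul_le_mul_of_nonneg_right h1 hpos.le
      nlinarith [mul_le_mul_of_nonneg_right hChalf hpos.le]
    · -- case b: A(D+W) < CW:  P(1+CW) ≥ C,  (D+W)A² ≤ CW,  (1-D-W) W (1+CW) ≤ 3/4
      have hge : C ≤ P * (1 + C * W) := by
        rw [hPm]
        have hd : 0 ≤ C * W - A * (D + W) := by linarith
        have : s * C * (C * W - A * (D + W)) ≤ 1 * C * (C * W - A * (D + W)) :=
          mul_le_mul_of_nonneg_right (mul_le_mul_of_nonneg_right hs (le_of_lt hCpos)) hd
        nlinarith [mul_nonneg hCpos.le (mul_nonneg hA hDWn)]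
      have hy : (D + W) * A ^ 2 ≤ C * W := by
        have h1 : (D + W) * A ^ 2 = A * (A * (D + W)) := by ring
        rw [h1]
        calc A * (A * (D + W)) ≤ A * (C * W) := mul_le_mul_of_nonneg_left hcase.le hA
          _ ≤ 1 * (C * W) := mul_le_mul_of_nonneg_right hA1 hCW
          _ = C * W := by ring
      have hz1 : (1 - D - W) * W * (1 + C * W) ≤ (1 - W) * W * (1 + W) := by
        have e1 : (1 - D - W) * W ≤ (1 - W) * W := by nlinarith
        have e2 : 1 + C * W ≤ 1 + W := by nlinarith
        have e0 : 0 ≤ (1 - D - W) * W := mul_nonneg (by linarith) hW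
        calc (1 - D - W) * W * (1 + C * W) ≤ (1 - D - W) * W * (1 + W) := mul_le_mul_of_nonneg_left e2 e0
          _ ≤ (1 - W) * W * (1 + W) := mul_le_mul_of_nonneg_right e1 (by linarith)
      have hz2 : (1 - W) * W * (1 + W) ≤ 3 / 4 := by
        have hW1 : W ≤ 1 := by linarith
        nlinarith [mul_nonneg (sq_nonneg (W - 1 / 2)) (by linarith : (0:ℝ) ≤ W + 1)]
      calc (1 - D - W) * (D + W) * A ^ 2 * (1 + C * W)
          = (1 - D - W) * ((D + W) * A ^ 2) * (1 + C * W) := by ring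
        _ ≤ (1 - D - W) * (C * W) * (1 + C * W) := by
            apply mul_le_mul_of_nonneg_right _ hpos.le
            exact mul_le_mul_of_nonneg_left hy (by linarith)
        _ = C * ((1 - D - W) * W * (1 + C * W)) := by ring
        _ ≤ C * (3 / 4) := mul_le_mul_of_nonneg_left (le_trans hz1 hz2) hCpos.le
        _ ≤ 3 / 4 * (P * (1 + C * W)) := by nlinarith
  have h1 : s - A ≤ 1 - A := by linarith
  have hsA0 : 0 ≤ s - A := by linarith
  have main2 : (1 - D - W) * (D + W) * A ^ 2 * (s - A) * (1 + C * W) ≤ 3 / 4 * (P * (1 + C * W)) * (1 - A) := by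
    have e0 : 0 ≤ (1 - D - W) * (D + W) * A ^ 2 * (1 + C * W) :=
      mul_nonneg (mul_nonneg hx0 (pow_nonneg hA 2)) hpos.le
    calc (1 - D - W) * (D + W) * A ^ 2 * (s - A) * (1 + C * W)
        = ((1 - D - W) * (D + W) * A ^ 2 * (1 + C * W)) * (s - A) := by ring
      _ ≤ ((1 - D - W) * (D + W) * A ^ 2 * (1 + C * W)) * (1 - A) := mul_le_mul_of_nonneg_left h1 e0
      _ ≤ (3 / 4 * (P * (1 + C * W))) * (1 - A) := mul_le_mul_of_nonneg_right M3 (by linarith)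
  have hCWs : 0 ≤ C * W * s := mul_nonneg hCW hs0
  have target : (1 - D - W) * A ^ 2 * W * (s - A) * (C * D * (s - v) + v) * (1 + C * W)
      ≤ 3 / 4 * P * v * (1 - A) * (1 + C * W) := by
    have eL : (1 - D - W) * A ^ 2 * W * (s - A) * (C * D * (s - v) + v) * (1 + C * W)
        = ((1 - D - W) * (D + W) * A ^ 2 * (s - A)) * (C * W * s) := by
      calc (1 - D - W) * A ^ 2 * W * (s - A) * (C * D * (s - v) + v) * (1 + C * W)
          = (1 - D - W) * A ^ 2 * W * (s - A) * ((C * D * (s - v) + v) * (1 + C * W)) := by ring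
        _ = ((1 - D - W) * (D + W) * A ^ 2 * (s - A)) * (C * W * s) := by rw [hbr]; ring
    have eR : 3 / 4 * P * v * (1 - A) * (1 + C * W) = (3 / 4 * P * (1 - A)) * (v * (1 + C * W)) := by ring
    rw [eL, eR, hv]
    have hXY : (1 - D - W) * (D + W) * A ^ 2 * (s - A) ≤ 3 / 4 * P * (1 - A) := by
      have := main2
      have h' : ((1 - D - W) * (D + W) * A ^ 2 * (s - A)) * (1 + C * W) ≤ (3 / 4 * P * (1 - A)) * (1 + C * W) := by
        calc ((1 - D - W) * (D + W) * A ^ 2 * (s - A)) * (1 + C * W)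
            = (1 - D - W) * (D + W) * A ^ 2 * (s - A) * (1 + C * W) := by ring
          _ ≤ 3 / 4 * (P * (1 + C * W)) * (1 - A) := this
          _ = (3 / 4 * P * (1 - A)) * (1 + C * W) := by ring
      exact le_of_mul_le_mul_right h' hpos
    exact mul_le_mul_of_nonneg_right hXY hCWs
  exact le_of_mul_le_mul_right target hpos

/-- **THE REDUCED CLAIM (RC) of THEOREM NX′₂.**  For `0 ≤ D`, `0 ≤ W`, `D + W ≤ 1`, `C(1+D) = 1`, `0 ≤ A ≤ s ≤ 1`,
`ω ∈ [0,1]` and `v` with `CW(s−v) ≤ v ≤ s` (i.e. `v ≥ CWm`, `m = s − v ≥ 0`), writing `M = A + C − AC` and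
`P = ωM + (1−ω)[C + A(1−C)s − C(1−A)v]` (the exact normalised far factor `p₀/p₁`):
`(1−D−W)·A²·W·(s−A)·[C·D·(ω + (1−ω)(s−v)) + (1−ω)v] ≤ ¾·P·v·(1−A)`.
(This is (RC) multiplied by `1−A`, with `(1−z)(1−A) = s−A`.)  Proof: affine in `ω`, concave in `v`; the four corners are
`rc_corner_I…IV`.  Sharp constant: the ratio of the two sides tends to `3` at `D = 0`, `W = ½`, `A, s → 1`, `ω → 0`.
[cite: KozmaNitzan2024, Question 8 (§5.5 p. 36)] -/
theorem rc_k2 (D W A s C v ω : ℝ) (hD : 0 ≤ D) (hW : 0 ≤ W) (hDW : D + W ≤ 1) (hA : 0 ≤ A) (hAs : A ≤ s)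
    (hs : s ≤ 1) (hC : C * (1 + D) = 1) (hω0 : 0 ≤ ω) (hω1 : ω ≤ 1) (hvlo : C * W * (s - v) ≤ v) (hvhi : v ≤ s) :
    (1 - D - W) * A ^ 2 * W * (s - A) * (C * D * (ω + (1 - ω) * (s - v)) + (1 - ω) * v)
      ≤ 3 / 4 * (ω * (A + C - A * C) + (1 - ω) * (C + A * (1 - C) * s - C * (1 - A) * v)) * v * (1 - A) := by
  have hCpos : 0 < C := by nlinarith
  have hCW : 0 ≤ C * W := mul_nonneg hCpos.le hW
  have hpos : 0 < 1 + C * W := by linarith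
  have hs0 : 0 ≤ s := le_trans hA hAs
  set v₀ := C * W * s / (1 + C * W) with hv₀def
  have hv₀ : v₀ * (1 + C * W) = C * W * s := by rw [hv₀def]; field_simp
  have hv₀le : v₀ ≤ v := by
    rw [hv₀def, div_le_iff₀ hpos]; nlinarith
  have F1 : 0 ≤ (3 / 4 * (A + C - A * C) * (1 - A)) * v - (1 - D - W) * A ^ 2 * W * (s - A) * C * D := by
    have c1 := rc_corner_I D W A s C hD hW hDW hA hAs hs hC
    have c3 := rc_corner_III D W A s C v₀ hD hW hDW hA hAs hs hC hv₀
    have h := concave_between (-((1 - D - W) * A ^ 2 * W * (s - A) * C * D)) (3 / 4 * (A + C - A * C) * (1 - A)) 0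
      v₀ s v (le_refl 0) (by nlinarith [c3]) (by nlinarith [c1]) hv₀le hvhi
    nlinarith [h]
  have F0 : 0 ≤ 3 / 4 * (C + A * (1 - C) * s - C * (1 - A) * v) * v * (1 - A)
      - (1 - D - W) * A ^ 2 * W * (s - A) * (C * D * (s - v) + v) := by
    have c2 := rc_corner_II D W A s C hD hW hDW hA hAs hs hCpos.le
    have c4 := rc_corner_IV D W A s C v₀ (C + A * (1 - C) * s - C * (1 - A) * v₀) hD hW hDW hA hAs hs hC hv₀ rfl
    have key : ∀ x : ℝ, 3 / 4 * (C + A * (1 - C) * s - C * (1 - A) * x) * x * (1 - A)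
        - (1 - D - W) * A ^ 2 * W * (s - A) * (C * D * (s - x) + x)
        = (-((1 - D - W) * A ^ 2 * W * (s - A) * C * D * s))
          + (3 / 4 * (C + A * (1 - C) * s) * (1 - A) - (1 - D - W) * A ^ 2 * W * (s - A) * (1 - C * D)) * x
          - (3 / 4 * C * (1 - A) ^ 2) * x ^ 2 := by intro x; ring
    have e2 : 3 / 4 * (C * (1 - s) + A * s) * s * (1 - A) = 3 / 4 * (C + A * (1 - C) * s - C * (1 - A) * s) * s * (1 - A) := by
      ring
    have h0 : 0 ≤ 3 / 4 * (C + A * (1 - C) * s - C * (1 - A) * v₀) * v₀ * (1 - A)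
        - (1 - D - W) * A ^ 2 * W * (s - A) * (C * D * (s - v₀) + v₀) := by linarith [c4]
    have h1 : 0 ≤ 3 / 4 * (C + A * (1 - C) * s - C * (1 - A) * s) * s * (1 - A)
        - (1 - D - W) * A ^ 2 * W * (s - A) * (C * D * (s - s) + s) := by
      have : (C * D * (s - s) + s) = s := by ring
      rw [this, ← e2]; linarith [c2]
    rw [key] at h0 h1
    have h := concave_between _ _ (3 / 4 * C * (1 - A) ^ 2) v₀ s v (by positivity) h0 h1 hv₀le hvhi
    rw [← key] at h
    exact h
  have e : 3 / 4 * (ω * (A + C - A * C) + (1 - ω) * (C + A * (1 - C) * s - C * (1 - A) * v)) * v * (1 - A)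
      - (1 - D - W) * A ^ 2 * W * (s - A) * (C * D * (ω + (1 - ω) * (s - v)) + (1 - ω) * v)
      = ω * ((3 / 4 * (A + C - A * C) * (1 - A)) * v - (1 - D - W) * A ^ 2 * W * (s - A) * C * D)
        + (1 - ω) * (3 / 4 * (C + A * (1 - C) * s - C * (1 - A) * v) * v * (1 - A)
            - (1 - D - W) * A ^ 2 * W * (s - A) * (C * D * (s - v) + v)) := by ring
  nlinarith [e, mul_nonneg hω0 F1, mul_nonneg (by linarith : (0:ℝ) ≤ 1 - ω) F0]

end PocketCert

end Summit.CriticalPhenomena.PercolationContinuityZ3.Theorems
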